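import Mathlib.GroupTheory.SpecificGroups.Cyclic
import Mathlib.Tactic.Linarith
import Mathlib.Tactic.Abel
import Summits.MatrixMultiplication.OmegaCensus.NearTilingTwoCosets
import Summits.MatrixMultiplication.OmegaCensus.DihedralLawModOneShapeBLemmas
import HarnessLib

/-!
# Periodic near-tilings with defect two: the quotient by the period is cyclic

ω-census, family (b3).  Framing: lottery ticket; floor = certified bounds/negative ranges.

Refinement of `two_cosets_of_near_tiling_two` / `two_cosets_of_three_pieces` used for the dicyclic-type groups
`G(A, c₀)`, `c₀ ≠ 0` (`DicyclicLawQuotientCyclic*.lean`).  Finite abelian `A`, `d, c₀ ∈ A` with `c₀ ≠ 0 = 2c₀`,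
and `P, C ⊆ A` with `A = P ⊔ (P + d) ⊔ C`, `C ∩ (C + d) = ∅`, `|P| = |C| + 2`; if moreover `P` and `C` are
`c₀`-PERIODIC (`P + c₀ = P`, `C + c₀ = C`), then not only is `A` the union of two cosets of `D = ⟨d⟩`, but
**`A = D ∪ (D + c₀)`**, i.e. `A/⟨c₀⟩` is cyclic, generated by the image of `d` (`near_tiling_two_periodic`).
Proof: as in the defect-two lemma, `c ↦ c + d` maps `C` into `P` missing a two-point set `M`, and every coset of `D`
meets `M`; periodicity makes `M` itself `c₀`-invariant, so `M = {p₁, p₁ + c₀}` and the cosets are `p₁ + D` and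
`p₁ + c₀ + D`.  `three_pieces_periodic` is the repackaging with `C ⊆ P + 2e` (only `P` need be periodic; `C` is the
complement of `P ⊔ (P + e)`), and `card_even_of_periodic` records that a `c₀`-periodic set has even size.
-/

namespace Summit.MatrixMultiplication.OmegaCensus

open Finset

section NearTilingPeriodic

variable {A : Type*} [AddCommGroup A] [Fintype A] [DecidableEq A]

/-- **Periodic defect-two near-tiling: `A = ⟨d⟩ ∪ (c₀ + ⟨d⟩)`.** [folklore] -/
theorem near_tiling_two_periodic {P C : Finset A} {d c₀ : A}
    (hPC : Disjoint P C) (hPdC : Disjoint (P.image fun x => x + d) C)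
    (hcov : P ∪ P.image (fun x => x + d) ∪ C = univ)
    (hCC : Disjoint C (C.image fun x => x + d)) (hcard : P.card = C.card + 2)
    (hPP : Disjoint P (P.image fun x => x + d))
    (hPper : P.image (fun x => x + c₀) = P) (hCper : C.image (fun x => x + c₀) = C)
    (hc₀ : c₀ ≠ 0) (h2c : c₀ + c₀ = 0) :
    ∀ x : A, x ∈ AddSubgroup.zmultiples d ∨ x + c₀ ∈ AddSubgroup.zmultiples d := by
  classical
  set D := AddSubgroup.zmultiples d with hDdef
  have hdD : d ∈ D := AddSubgroup.mem_zmultiples d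
  have memA : ∀ x : A, x ∈ P ∨ x ∈ P.image (fun x => x + d) ∨ x ∈ C := by
    intro x
    have hx : x ∈ P ∪ P.image (fun x => x + d) ∪ C := by rw [hcov]; exact mem_univ x
    simpa [mem_union, or_assoc] using hx
  have hCP : ∀ c ∈ C, c + d ∈ P := by
    intro c hc
    rcases memA (c + d) with h | h | h
    · exact h
    · obtain ⟨p, hp, hpe⟩ := mem_image.1 h
      have : p = c := add_right_cancel hpe
      subst this
      exact absurd hc (disjoint_left.1 hPC hp)
    · exact absurd (mem_image_of_mem (fun x => x + d) hc) (disjoint_left.1 hCC h)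
  -- the image `C + d ⊆ P` misses exactly two points: `M`
  have himg : C.image (fun x => x + d) ⊆ P := image_subset_iff.2 hCP
  have hcimg : (C.image fun x => x + d).card = C.card := card_image_of_injective _ (add_left_injective d)
  set M := P \ C.image (fun x => x + d) with hMdef
  have hM2 : M.card = 2 := by rw [hMdef, card_sdiff_of_subset himg, hcimg, hcard]; omega
  obtain ⟨p₁, p₂, hp12, hM⟩ := card_eq_two.1 hM2
  have hMP : M ⊆ P := sdiff_subset
  have hPre : ∀ p ∈ P, p ∉ M → ∃ c ∈ C, c + d = p := by
    intro p hp hne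
    by_contra hnot
    exact hne (mem_sdiff.2 ⟨hp, fun h => hnot (by simpa using mem_image.1 h)⟩)
  -- cosets of `D` as finsets; all have the size of `D`
  have Kcard : ∀ x : A, (univ.filter fun y => y - x ∈ D).card = (univ.filter fun y => y ∈ D).card := by
    intro x
    have hK : (univ.filter fun y => y ∈ D).image (fun y => y + x) = univ.filter fun y => y - x ∈ D := by
      ext y
      simp only [mem_image, mem_filter, mem_univ, true_and]
      constructor
      · rintro ⟨z, hz, rfl⟩; simpa using hz
      · intro hy; exact ⟨y - x, hy, sub_add_cancel y x⟩
    rw [← hK, card_image_of_injective _ (add_left_injective x)]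
  have shiftD : ∀ x y : A, y - x ∈ D → y + d - x ∈ D := fun x y h => by
    have := D.add_mem h hdD; rwa [sub_add_eq_add_sub] at this
  have shiftD' : ∀ x y : A, y - x ∈ D → y - d - x ∈ D := fun x y h => by
    have := D.sub_mem h hdD; rwa [sub_right_comm] at this
  have Kdecomp : ∀ x : A, (univ.filter fun y => y - x ∈ D).card =
      (P.filter fun y => y - x ∈ D).card + ((P.image fun x => x + d).filter fun y => y - x ∈ D).card +
        (C.filter fun y => y - x ∈ D).card := by
    intro x
    rw [← hcov, filter_union, filter_union,
      card_union_of_disjoint (disjoint_union_left.2 ⟨disjoint_filter_filter hPC, disjoint_filter_filter hPdC⟩),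
      card_union_of_disjoint (disjoint_filter_filter hPP)]
  have KPd : ∀ x : A, ((P.image fun x => x + d).filter fun y => y - x ∈ D).card =
      (P.filter fun y => y - x ∈ D).card := by
    intro x
    have hEq : (P.filter fun y => y - x ∈ D).image (fun y => y + d) =
        (P.image fun x => x + d).filter fun y => y - x ∈ D := by
      ext y
      simp only [mem_image, mem_filter]
      constructor
      · rintro ⟨p, ⟨hp, hpD⟩, rfl⟩; exact ⟨⟨p, hp, rfl⟩, shiftD x p hpD⟩
      · rintro ⟨⟨p, hp, rfl⟩, hD⟩
        exact ⟨p, ⟨hp, by have := shiftD' x (p + d) hD; rwa [add_sub_cancel_right] at this⟩, rfl⟩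
    rw [← hEq, card_image_of_injective _ (add_left_injective d)]
  -- `|C ∩ K| + |M ∩ K| = |P ∩ K|` for every coset `K`
  have KCM : ∀ x : A, (C.filter fun y => y - x ∈ D).card + (M.filter fun y => y - x ∈ D).card =
      (P.filter fun y => y - x ∈ D).card := by
    intro x
    have hEq : (C.filter fun y => y - x ∈ D).image (fun y => y + d) ∪ (M.filter fun y => y - x ∈ D) =
        P.filter fun y => y - x ∈ D := by
      ext y
      simp only [mem_union, mem_image, mem_filter]
      constructor
      · rintro (⟨c, ⟨hc, hcD⟩, rfl⟩ | ⟨hyM, hyD⟩)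
        · exact ⟨hCP c hc, shiftD x c hcD⟩
        · exact ⟨hMP hyM, hyD⟩
      · rintro ⟨hy, hyD⟩
        by_cases hyM : y ∈ M
        · exact Or.inr ⟨hyM, hyD⟩
        · obtain ⟨c, hc, rfl⟩ := hPre y hy hyM
          exact Or.inl ⟨c, ⟨hc, by have := shiftD' x (c + d) hyD; rwa [add_sub_cancel_right] at this⟩, rfl⟩
    have hdis : Disjoint ((C.filter fun y => y - x ∈ D).image (fun y => y + d)) (M.filter fun y => y - x ∈ D) := by
      rw [disjoint_left]
      rintro y hy hyM
      obtain ⟨c, hc, rfl⟩ := mem_image.1 hy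
      have : c + d ∈ C.image (fun x => x + d) := mem_image_of_mem _ (mem_filter.1 hc).1
      exact (mem_sdiff.1 (mem_filter.1 hyM).1).2 this
    rw [← hEq, card_union_of_disjoint hdis, card_image_of_injective _ (add_left_injective d)]
  -- every coset meets `M`
  have hmeet : ∀ x : A, 1 ≤ (M.filter fun y => y - x ∈ D).card := by
    intro x
    by_contra h0
    have h0' : (M.filter fun y => y - x ∈ D).card = 0 := by omega
    have h1 := Kdecomp x
    have h2 := Kdecomp p₁
    have m1 := KCM x
    have m2 := KCM p₁
    rw [KPd x, Kcard x] at h1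
    rw [KPd p₁, Kcard p₁] at h2
    have hp₁M : p₁ ∈ M.filter fun y => y - p₁ ∈ D := mem_filter.2 ⟨by rw [hM]; simp, by rw [sub_self]; exact D.zero_mem⟩
    have hge : 1 ≤ (M.filter fun y => y - p₁ ∈ D).card := card_pos.2 ⟨p₁, hp₁M⟩
    have hle : (M.filter fun y => y - p₁ ∈ D).card ≤ 2 := (card_le_card (filter_subset _ M)).trans hM2.le
    omega
  -- PERIODIC REFINEMENT: `M = P \ (C + d)` is `c₀`-invariant, so `M = {p₁, p₁ + c₀}`
  have hMper : ∀ y ∈ M, y + c₀ ∈ M := by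
    intro y hy
    rw [hMdef, mem_sdiff] at hy ⊢
    refine ⟨?_, fun h => hy.2 ?_⟩
    · rw [← hPper]; exact mem_image_of_mem _ hy.1
    · obtain ⟨c, hc, hce⟩ := mem_image.1 h
      -- `c + d = y + c₀`, so `(c + c₀) + d = y` with `c + c₀ ∈ C`
      have hc' : c + c₀ ∈ C := by rw [← hCper]; exact mem_image_of_mem _ hc
      refine mem_image.2 ⟨c + c₀, hc', ?_⟩
      have : c + c₀ + d = (c + d) + c₀ := by abel
      rw [this, hce, add_assoc, h2c, add_zero]
  have hp₁M : p₁ ∈ M := by rw [hM]; exact mem_insert_self _ _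
  have hp₂ : p₂ = p₁ + c₀ := by
    have h1 : p₁ + c₀ ∈ M := hMper p₁ hp₁M
    rw [hM, mem_insert, mem_singleton] at h1
    rcases h1 with h1 | h1
    · exact absurd (add_left_cancel (a := p₁) (b := c₀) (c := 0) (by rw [add_zero]; exact h1)) hc₀
    · exact h1.symm
  -- every coset of `D` meets `M = {p₁, p₁ + c₀}`; apply this to `x` and to `0`
  have hcos : ∀ x : A, x - p₁ ∈ D ∨ x - p₁ - c₀ ∈ D := by
    intro x
    obtain ⟨y, hy⟩ := card_pos.1 (hmeet x)
    rw [mem_filter, hM, mem_insert, mem_singleton] at hy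
    rcases hy with ⟨rfl | rfl, hyD⟩
    · left; have := D.neg_mem hyD; rwa [neg_sub] at this
    · right; have := D.neg_mem hyD; rwa [neg_sub, hp₂, ← sub_sub] at this
  intro x
  rcases hcos x with hx | hx <;> rcases hcos 0 with h0 | h0
  · left; convert D.sub_mem hx h0 using 1; abel
  · right; convert D.sub_mem hx h0 using 1; abel
  · right
    have h1 := D.sub_mem hx h0
    have e : x + c₀ = x - p₁ - c₀ - (0 - p₁) + (c₀ + c₀) := by abel
    rw [e, h2c, add_zero]; exact h1
  · left; convert D.sub_mem hx h0 using 1; abel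

/-- **Three periodic pieces** `P`, `P + e`, `C` tiling `A` with `|P| = |C| + 2`, `C ⊆ P + 2e` and `P + c₀ = P`
(`c₀ ≠ 0 = 2c₀`): `A = ⟨e⟩ ∪ (c₀ + ⟨e⟩)`. [folklore] -/
theorem three_pieces_periodic {P C : Finset A} {e c₀ : A}
    (hPC : Disjoint P C) (hPe : Disjoint P (P.image (· + e))) (hPeC : Disjoint (P.image (· + e)) C)
    (hcardA : P.card + P.card + C.card = Fintype.card A) (hcard : P.card = C.card + 2)
    (hCsub : C ⊆ P.image (· + (e + e))) (hPper : P.image (· + c₀) = P) (hc₀ : c₀ ≠ 0) (h2c : c₀ + c₀ = 0) :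
    ∀ x : A, x ∈ AddSubgroup.zmultiples e ∨ x + c₀ ∈ AddSubgroup.zmultiples e := by
  have hcov : P ∪ P.image (· + e) ∪ C = univ := by
    apply eq_univ_of_card
    rw [card_union_of_disjoint (disjoint_union_left.2 ⟨hPC, hPeC⟩), card_union_of_disjoint hPe,
      card_image_add, hcardA]
  have hCC : Disjoint C (C.image (· + e)) := by
    have h1 : Disjoint (P.image (· + (e + e))) (P.image (· + (e + e + e))) := disjoint_shift hPe (e + e)
    refine disjoint_of_subset_left hCsub (disjoint_of_subset_right ?_ h1)
    intro x hx
    obtain ⟨c, hc, rfl⟩ := mem_image.1 hx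
    obtain ⟨p, hp, rfl⟩ := mem_image.1 (hCsub hc)
    exact mem_image.2 ⟨p, hp, (add_assoc p (e + e) e).symm⟩
  -- `P + e` is periodic, hence so is the complement `C`
  have hPeper : (P.image (· + e)).image (· + c₀) = P.image (· + e) := by
    rw [image_add_image, add_comm e c₀, ← image_add_image, hPper]
  have hCper : C.image (· + c₀) = C := by
    apply eq_of_subset_of_card_le _ (by rw [card_image_add])
    intro x hx
    obtain ⟨c, hc, rfl⟩ := mem_image.1 hx
    have hx' : c + c₀ ∈ P ∪ P.image (· + e) ∪ C := by rw [hcov]; exact mem_univ _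
    rcases mem_union.1 hx' with h | h
    · rcases mem_union.1 h with h | h
      · -- `c + c₀ ∈ P` ⇒ `c = (c + c₀) + c₀ ∈ P`, contradicting `P ∩ C = ∅`
        have : c + c₀ + c₀ ∈ P := by rw [← hPper]; exact mem_image_of_mem _ h
        rw [add_assoc, h2c, add_zero] at this
        exact absurd hc (disjoint_left.1 hPC this)
      · have : c + c₀ + c₀ ∈ P.image (· + e) := by rw [← hPeper]; exact mem_image_of_mem _ h
        rw [add_assoc, h2c, add_zero] at this
        exact absurd hc (disjoint_left.1 hPeC this)
    · exact h
  exact near_tiling_two_periodic hPC hPeC hcov hCC hcard hPe hPper hCper hc₀ h2c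

omit [Fintype A] in
/-- A `c₀`-periodic finite set (`c₀ ≠ 0 = 2c₀`) has even cardinality (`x ↦ x + c₀` is a fixed-point-free involution
of it). [folklore] -/
theorem card_even_of_periodic {X : Finset A} {c₀ : A} (hper : X.image (· + c₀) = X) (hc₀ : c₀ ≠ 0)
    (h2c : c₀ + c₀ = 0) : 2 ∣ X.card := by
  classical
  -- strong induction on `|X|`: remove the pair `{x, x + c₀}`
  induction hX : X.card using Nat.strong_induction_on generalizing X with
  | _ n ih =>
    rcases X.eq_empty_or_nonempty with rfl | ⟨x, hx⟩
    · rw [← hX, card_empty]; exact dvd_zero 2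
    · have hxc : x + c₀ ∈ X := by rw [← hper]; exact mem_image_of_mem _ hx
      have hne : x + c₀ ≠ x := fun h => hc₀ (add_left_cancel (a := x) (by rw [h, add_zero]))
      set X' := (X.erase x).erase (x + c₀) with hX'
      have hcard' : X'.card + 2 = X.card := by
        rw [hX', card_erase_of_mem (mem_erase.2 ⟨hne, hxc⟩), card_erase_of_mem hx]
        have := card_pos.2 ⟨x, hx⟩
        have h2 : 2 ≤ X.card := by
          have : ({x, x + c₀} : Finset A) ⊆ X := by
            intro y hy; rw [mem_insert, mem_singleton] at hy; rcases hy with rfl | rfl; exact hx; exact hxc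
          have := card_le_card this
          rwa [card_insert_of_notMem (by rwa [mem_singleton, eq_comm]), card_singleton] at this
        omega
      have hper' : X'.image (· + c₀) = X' := by
        apply eq_of_subset_of_card_le _ (by rw [card_image_add])
        intro y hy
        obtain ⟨z, hz, rfl⟩ := mem_image.1 hy
        rw [hX', mem_erase, mem_erase] at hz ⊢
        obtain ⟨hz1, hz2, hz3⟩ := hz
        refine ⟨fun h => hz2 ?_, fun h => hz1 ?_, by rw [← hper]; exact mem_image_of_mem _ hz3⟩
        · exact add_right_cancel h
        · have : z + c₀ + c₀ = x + c₀ := by rw [h]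
          rwa [add_assoc, h2c, add_zero] at this
      have := ih X'.card (by omega) hper' rfl
      omega

end NearTilingPeriodic

end Summit.MatrixMultiplication.OmegaCensus
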